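import Summits.ValiantsHypothesis.ValiantsHypothesis.Theorems.NNDivisionHard.Negative.RealLambdaBlind
import Literature.Combinatorics.Optimization.PatternMatrixRankUpperBounds
import Literature.Computability.Complexity.SimpleOutputsHittingSet

/-!
# Real-λ blindness of the located permutahedron pencil, part 2b (§5): the bound in the tree's currency `HasNonnegFactorization (pencil n λ) ((n+1)^(4T+1))`

Port (val-port-2 g4, desk 02:14Z hand) of `Cruxes/NNDivisionHard/RealLambda39.lean` rev 4 @311ce0a993de §5 (author val-idea-39 g5, staged
`pub/ideators/val-idea-39/lmr/staged/g5-RealLambda/RealLambdaBlind.lean` 6ed580777ec1d6a0): the author's part 2 (§3 + §5, 498 l.) exceeds the gate's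
400-line cap for Theorems files with proofs, so §5 is split off VERBATIM into this sibling (decl texts unchanged; docstrings added where the lint asks).
Content: `pencil`, `LiveSlot`, `card_liveSlot_le` (`card_subsets_le` = ✓ `Literature.Computability.Complexity.card_lowSet_le` by import), ★★★ `hasNonnegFactorization_pencil_poly` — `real_rankPlus_le` (part 2a) packaged as
`Literature.Combinatorics.Optimization.HasNonnegFactorization` with an explicit polynomial size.  Negative/calibration lane (S2 visibility of ONE certificate
family); no item closes; 21181 OPEN; VP ≠ VNP NOT proved.
-/

set_option linter.dupNamespace false

namespace Summit.ValiantsHypothesis.Theorems.NNDivisionHardNegative.RealLambda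

open Finset
open Summit.ValiantsHypothesis.Theorems.NNDivisionHardNegative.BlindCubeIdentity (ind)
open Summit.ValiantsHypothesis.Theorems.NNDivisionHardNegative.WeakReliefBlind (posLT invInd inv card_posLT)

noncomputable section

variable {n : ℕ}


/-! ## §5  The bound in the tree's currency: `HasNonnegFactorization M_λ ((n+1)^(4T+1))`

`real_rankPlus_le` packaged as `Literature.Combinatorics.Optimization.HasNonnegFactorization` (the notion the calibration theorems
`…Theorems.NNDivisionHard.Calibration.nonnegRank_C3` and the extended-formulation lemmas consume) with an EXPLICIT POLYNOMIAL size: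
the live slots `(size class, conjunction of ≤ 2T literals)` inject into `Fin (n+1) × {S // |S| ≤ 2T}²`, and `#{S ⊆ [n] : |S| ≤ D} ≤ (n+1)^D`.
So `rank₊ M_λ^{(n)} ≤ (n+1)^{4⌈2/λ⌉+1}` for every real `λ > 0` — polynomial for each fixed `λ`, quasi-polynomial down to `λ ≍ 1/polylog n`. -/

section Currency

open Literature.Combinatorics.Optimization (HasNonnegFactorization hasNonnegFactorization_of_fintype)

/-- The located permutahedron pencil as a real matrix: rows `a ⊆ [n]`, columns `(b, π)`:
`M_λ[a; (b,π)] = (1 − |a ∩ b|)² + λ·inv(a;π)`. -/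
def pencil (n : ℕ) (lam : ℝ) (a : Finset (Fin n)) (bπ : Finset (Fin n) × Equiv.Perm (Fin n)) : ℝ :=
  ((1 : ℝ) - ((a ∩ bπ.1).card : ℝ)) ^ 2 + lam * (inv a bπ.2 : ℝ)

/-- Live slots: a size class together with a conjunction of at most `2T` literals. -/
abbrev LiveSlot (n T : ℕ) := {s : Slot n // s.2.1.card + s.2.2.card ≤ 2 * T}

/-- T1 in the tree's currency, slot form: `M_λ` has a nonnegative factorization through the live slots. -/
theorem hasNonnegFactorization_pencil (n : ℕ) (lam : ℝ) (hlam : 0 < lam) (T : ℕ) (hT : 2 ≤ lam * T) :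
    HasNonnegFactorization (pencil n lam) (Fintype.card (LiveSlot n T)) := by
  classical
  obtain ⟨U, V, hU, hV, hdeg, hM⟩ := real_rankPlus_le n lam hlam T hT
  refine hasNonnegFactorization_of_fintype (fun a (s : LiveSlot n T) => U a s.1) (fun s bπ => V bπ s.1)
    (fun _ _ => hU _ _) (fun _ _ => hV _ _) ?_
  rintro a ⟨b, π⟩
  show pencil n lam a (b, π) = ∑ s : LiveSlot n T, U a s.1 * V (b, π) s.1
  unfold pencil
  rw [hM a b π, ← Finset.sum_filter_of_ne (p := fun s : Slot n => s.2.1.card + s.2.2.card ≤ 2 * T)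
    (fun s _ hs => hdeg a s (left_ne_zero_of_mul hs))]
  exact Finset.sum_subtype _ (fun s => by simp) _

/-- `Σ_{d ≤ D} n^d ≤ (n+1)^D`. -/
theorem sum_pow_le (n D : ℕ) : ∑ d ∈ Finset.range (D + 1), n ^ d ≤ (n + 1) ^ D := by
  induction D with
  | zero => simp
  | succ D ih =>
    rw [Finset.sum_range_succ]
    have h1 : n ^ D ≤ (n + 1) ^ D := Nat.pow_le_pow_left (Nat.le_succ n) D
    calc _ ≤ (n + 1) ^ D + n * (n + 1) ^ D := by
          rw [pow_succ']; exact add_le_add ih (Nat.mul_le_mul_left _ h1)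
      _ = (n + 1) ^ (D + 1) := by ring

-- `card_subsets_le` (= `#{S ⊆ [n] : |S| ≤ D} ≤ (n+1)^D`) is ✓ `Literature.Computability.Complexity.card_lowSet_le`, imported by name (gate dedup).

/-- The live slots are polynomially many: `#LiveSlot n T ≤ (n+1)^(4T+1)`. -/
theorem card_liveSlot_le (n T : ℕ) : Fintype.card (LiveSlot n T) ≤ (n + 1) ^ (4 * T + 1) := by
  classical
  let f : LiveSlot n T →
      Fin (n + 1) × ({S : Finset (Fin n) // S.card ≤ 2 * T} × {S : Finset (Fin n) // S.card ≤ 2 * T}) :=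
    fun s => (s.1.1, ⟨s.1.2.1, by have := s.2; omega⟩, ⟨s.1.2.2, by have := s.2; omega⟩)
  have hf : Function.Injective f := by
    rintro ⟨⟨i, S, R⟩, h⟩ ⟨⟨i', S', R'⟩, h'⟩ hff
    simp only [f, Prod.mk.injEq, Subtype.mk.injEq] at hff
    obtain ⟨rfl, rfl, rfl⟩ := hff
    rfl
  calc Fintype.card (LiveSlot n T)
      ≤ Fintype.card (Fin (n + 1) × ({S : Finset (Fin n) // S.card ≤ 2 * T} × {S : Finset (Fin n) // S.card ≤ 2 * T})) :=
        Fintype.card_le_of_injective f hf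
    _ = (n + 1) * (Fintype.card {S : Finset (Fin n) // S.card ≤ 2 * T} *
          Fintype.card {S : Finset (Fin n) // S.card ≤ 2 * T}) := by
        rw [Fintype.card_prod, Fintype.card_prod, Fintype.card_fin]
    _ ≤ (n + 1) * ((n + 1) ^ (2 * T) * (n + 1) ^ (2 * T)) := by
        gcongr <;> exact Literature.Computability.Complexity.card_lowSet_le n (2 * T)
    _ = (n + 1) ^ (4 * T + 1) := by ring

/-- ★★★ **T1 in the tree's currency, polynomial form: `rank₊ M_λ^{(n)} ≤ (n+1)^(4T+1)` whenever `λ·T ≥ 2`** (take `T = ⌈2/λ⌉`):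
for every FIXED real `λ > 0` the located permutahedron pencil has nonnegative rank polynomial in `n`; there is no positive
visibility threshold `λ_c`.  (S2 of `SmallLambda39.md` §6; memo `RealLambda39.md`.)  VP ≠ VNP is NOT proved by this. -/
theorem hasNonnegFactorization_pencil_poly (n : ℕ) (lam : ℝ) (hlam : 0 < lam) (T : ℕ) (hT : 2 ≤ lam * T) :
    HasNonnegFactorization (pencil n lam) ((n + 1) ^ (4 * T + 1)) :=
  (hasNonnegFactorization_pencil n lam hlam T hT).mono (card_liveSlot_le n T)

end Currency

end

end Summit.ValiantsHypothesis.Theorems.NNDivisionHardNegative.RealLambda
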